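import Summits.AtomisticToContinuum.HydrodynamicLimit.Theorems.CollisionIsometryCLTCollisionalTransferLocalityDefs
import HarnessLib

/-!
# Time integrals of `L²`-bounded processes converging in probability (stub
`tendsto_measure_setIntegral_of_forall`, line hemisphere-affine-slaving, crux 9518)

Generic measure theory for the equilibrium rung of the line `hemisphere-affine-slaving` of the crux
`CollisionalTransferLocality` (stmt-AtomisticToContinuum-9518). There the residual contains a time
integral `∫_{s ∈ [0,τ]} X_N(s, ω) ds` of a jointly measurable process on a sequence of probability
spaces `(Ω N, P N)` (the local Gibbs laws), where for each fixed time `s` the slice `X_N(s, ·) → 0`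
in probability and the second moments `∫ X_N(s, ·)² dP_N ≤ C` are bounded uniformly in `(N, s)`.
This file converts that into convergence in probability of the time integral.

Proof (all standard): truncation `|x| ≤ ε + K·𝟙{ε < |x|} + x²/K` gives
`E|X_N(s)| ≤ ε + K·P_N{ε < |X_N(s)|} + C/K`, whence `E|X_N(s)| → 0` for each `s` and
`E|X_N(s)| ≤ 2 + C` uniformly; dominated convergence in `s` on `[0, τ]` gives
`∫₀^τ E|X_N(s)| ds → 0`; Tonelli and Markov give
`P_N{δ < |∫₀^τ X_N(s) ds|} ≤ δ⁻¹ ∫₀^τ E|X_N(s)| ds → 0`.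
Everything is phrased with lower Lebesgue integrals `∫⁻ ‖·‖ₑ`, so no integrability of the time
slices `s ↦ X_N(s, ω)` is needed (`‖∫ f‖ₑ ≤ ∫⁻ ‖f‖ₑ` holds unconditionally).

* `lintegral_enorm_le_truncation` : the integrated truncation inequality;
* `tendsto_lintegral_enorm_of_tendsto_measure` : `L¹` convergence on varying probability spaces
  from convergence in probability plus a uniform second-moment bound;
* `tendsto_measure_setIntegral_of_forall` : the registered stub.

Square-integrability of each slice `X N s` (hypothesis `MemLp (X N s) 2 (P N)`) is genuinely
needed: the Bochner bound `∫ X² ≤ C` alone is vacuous for non-square-integrable slices (junk value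
`0`), and without it the conclusion fails (e.g. `X_N(s, ω) = N·𝟙{|ω - s| < 1/(2N)} + g(ω)/N` on
`[0,1]` with `g ∈ L¹ ∖ L²`).
-/

namespace Summit.AtomisticToContinuum.HydrodynamicLimit.Theorems.HemisphereAffineSlaving

open scoped BigOperators Topology Classical ENNReal InnerProductSpace
open Filter Set Function MeasureTheory

noncomputable section

open Literature.MathematicalPhysics.KineticTheory (T3 V3)

/-- Integrated truncation inequality on a probability space: for a measurable real `Y` with
square-integrable `Y²` of integral at most `C`, and `0 < ε`, `0 < K`,
`∫⁻ ‖Y‖ₑ ≤ ε + K · P{ε < |Y|} + C / K` (from the pointwise bound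
`|y| ≤ ε + K·𝟙{ε < |y|} + y²/K`). [folklore] -/
theorem lintegral_enorm_le_truncation {Ω : Type} [MeasurableSpace Ω] (P : Measure Ω)
    [IsProbabilityMeasure P] {Y : Ω → ℝ} (hY : Measurable Y)
    (hY2 : Integrable (fun ω => Y ω ^ 2) P) {C : ℝ} (hC : ∫ ω, Y ω ^ 2 ∂P ≤ C) {ε K : ℝ}
    (hK : 0 < K) :
    ∫⁻ ω, ‖Y ω‖ₑ ∂P ≤
      ENNReal.ofReal ε + ENNReal.ofReal K * P {ω | ε < |Y ω|} + ENNReal.ofReal (C / K) := by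
  have hS : MeasurableSet {ω | ε < |Y ω|} :=
    measurableSet_lt measurable_const (continuous_abs.measurable.comp hY)
  have hmeas2 : Measurable fun ω => ENNReal.ofReal (Y ω ^ 2 / K) :=
    ((hY.pow_const 2).div_const K).ennreal_ofReal
  calc ∫⁻ ω, ‖Y ω‖ₑ ∂P
      ≤ ∫⁻ ω, (ENNReal.ofReal ε + ({ω | ε < |Y ω|} : Set Ω).indicator (fun _ => ENNReal.ofReal K) ω
          + ENNReal.ofReal (Y ω ^ 2 / K)) ∂P := by
        refine lintegral_mono fun ω => ?_
        rw [Real.enorm_eq_ofReal_abs]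
        rcases le_or_gt |Y ω| ε with h1 | h1
        · exact le_add_right (le_add_right (ENNReal.ofReal_le_ofReal h1))
        rcases le_or_gt |Y ω| K with h2 | h2
        · refine le_add_right (le_add_left ?_)
          have hmem : ω ∈ ({ω | ε < |Y ω|} : Set Ω) := h1
          simp only [Set.indicator_of_mem hmem]
          exact ENNReal.ofReal_le_ofReal h2
        · refine le_add_left (ENNReal.ofReal_le_ofReal ?_)
          rw [le_div_iff₀ hK, ← sq_abs]
          nlinarith [abs_nonneg (Y ω)]
    _ = ENNReal.ofReal ε + ENNReal.ofReal K * P {ω | ε < |Y ω|}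
          + ∫⁻ ω, ENNReal.ofReal (Y ω ^ 2 / K) ∂P := by
        rw [lintegral_add_right _ hmeas2, lintegral_add_left measurable_const, lintegral_const,
          measure_univ, mul_one, lintegral_indicator_const hS]
    _ ≤ ENNReal.ofReal ε + ENNReal.ofReal K * P {ω | ε < |Y ω|} + ENNReal.ofReal (C / K) := by
        refine add_le_add le_rfl ?_
        rw [← ofReal_integral_eq_lintegral_ofReal (hY2.div_const K)
          (Eventually.of_forall fun ω => div_nonneg (sq_nonneg (Y ω)) hK.le), integral_div]
        exact ENNReal.ofReal_le_ofReal (div_le_div_of_nonneg_right hC hK.le)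

/-- `L¹` convergence to `0` on VARYING probability spaces `(Ω N, P N)` of a sequence of measurable
reals `Y N` that converge to `0` in probability (`P N {δ < |Y N|} → 0` for every `δ > 0`) and have
second moments bounded uniformly in `N`: `∫⁻ ‖Y N‖ₑ dP N → 0`. (Vitali-type statement; proved from
the truncation inequality `lintegral_enorm_le_truncation`.) [folklore] -/
theorem tendsto_lintegral_enorm_of_tendsto_measure {Ω : ℕ → Type} [∀ N, MeasurableSpace (Ω N)]
    (P : (N : ℕ) → Measure (Ω N)) [∀ N, IsProbabilityMeasure (P N)] {Y : (N : ℕ) → Ω N → ℝ}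
    (hY : ∀ N, Measurable (Y N)) (hY2 : ∀ N, Integrable (fun ω => Y N ω ^ 2) (P N)) {C : ℝ}
    (hC : ∀ N, ∫ ω, Y N ω ^ 2 ∂P N ≤ C)
    (hlim : ∀ δ : ℝ, 0 < δ → Tendsto (fun N => P N {ω | δ < |Y N ω|}) atTop (𝓝 0)) :
    Tendsto (fun N => ∫⁻ ω, ‖Y N ω‖ₑ ∂P N) atTop (𝓝 0) := by
  have hC0 : 0 ≤ C := (integral_nonneg fun ω => sq_nonneg (Y 0 ω)).trans (hC 0)
  rw [ENNReal.tendsto_nhds_zero]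
  intro η hη
  rcases eq_or_ne η ⊤ with rfl | hηtop
  · exact Eventually.of_forall fun _ => le_top
  have ht : 0 < η.toReal := ENNReal.toReal_pos hη.ne' hηtop
  set t : ℝ := η.toReal with ht_def
  obtain ⟨K, hK0, hCK⟩ : ∃ K : ℝ, 0 < K ∧ C / K ≤ t / 3 := by
    refine ⟨3 * (C + 1) / t, by positivity, ?_⟩
    rw [div_le_iff₀ (by positivity), div_mul_div_comm, le_div_iff₀ (by positivity)]
    nlinarith
  have h1 : Tendsto (fun N => ENNReal.ofReal K * P N {ω | t / 3 < |Y N ω|}) atTop (𝓝 0) := by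
    have h := ENNReal.Tendsto.const_mul (hlim (t / 3) (by positivity)) (a := ENNReal.ofReal K)
      (Or.inr ENNReal.ofReal_ne_top)
    simpa only [mul_zero] using h
  have hev : ∀ᶠ N in atTop,
      ENNReal.ofReal K * P N {ω | t / 3 < |Y N ω|} ≤ ENNReal.ofReal (t / 3) :=
    ENNReal.tendsto_nhds_zero.1 h1 _ (ENNReal.ofReal_pos.2 (by positivity))
  filter_upwards [hev] with N hN
  calc ∫⁻ ω, ‖Y N ω‖ₑ ∂P N
      ≤ ENNReal.ofReal (t / 3) + ENNReal.ofReal K * P N {ω | t / 3 < |Y N ω|}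
          + ENNReal.ofReal (C / K) :=
        lintegral_enorm_le_truncation (P N) (hY N) (hY2 N) (hC N) hK0
    _ ≤ ENNReal.ofReal (t / 3) + ENNReal.ofReal (t / 3) + ENNReal.ofReal (t / 3) :=
        add_le_add_three le_rfl hN (ENNReal.ofReal_le_ofReal hCK)
    _ = η := by
        rw [← ENNReal.ofReal_add (by positivity) (by positivity),
          ← ENNReal.ofReal_add (by positivity) (by positivity),
          show t / 3 + t / 3 + t / 3 = t by ring, ht_def, ENNReal.ofReal_toReal hηtop]

/-- **Time integrals of processes converging in probability.** On a sequence of probability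
spaces `(Ω N, P N)` let `X N : ℝ → Ω N → ℝ` be jointly measurable processes whose slices
`X N s` (`s ∈ [0, τ]`) are square integrable with second moments bounded uniformly in `(N, s)`
and converge to `0` in probability for each fixed `s ∈ [0, τ]`. Then the time integrals
`∫_{s ∈ [0,τ]} X N s ω` converge to `0` in probability. (Truncation + dominated convergence in
`s` for `s ↦ E|X N s|`, Tonelli, Markov.) [folklore] -/
theorem tendsto_measure_setIntegral_of_forall : ∀ {Ω : ℕ → Type} [∀ N, MeasurableSpace (Ω N)] (P : (N : ℕ) → MeasureTheory.Measure (Ω N)), (∀ N, IsProbabilityMeasure (P N)) → ∀ {τ : ℝ}, 0 ≤ τ → ∀ (X : (N : ℕ) → ℝ → Ω N → ℝ), (∀ N, Measurable (Function.uncurry (X N))) → (∀ N, ∀ s ∈ Icc 0 τ, MemLp (X N s) 2 (P N)) → ∀ {C : ℝ}, (∀ N, ∀ s ∈ Icc 0 τ, ∫ ω, X N s ω ^ 2 ∂P N ≤ C) → (∀ s ∈ Icc 0 τ, ∀ δ : ℝ, 0 < δ → Tendsto (fun N : ℕ => P N {ω | δ < |X N s ω|}) atTop (𝓝 0)) → ∀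 δ : ℝ, 0 < δ → Tendsto (fun N : ℕ => P N {ω | δ < |∫ s in Icc 0 τ, X N s ω|}) atTop (𝓝 0) := by
  intro Ω _ P hP τ _hτ X hXm hL2 C hC hlim δ hδ
  -- measurability of the slices and of the two partial integrals of `‖X N s ω‖ₑ`
  have hXs : ∀ N s, Measurable (X N s) := fun N _ => (hXm N).of_uncurry_left
  have hunc : ∀ N, Measurable (uncurry fun s ω => ‖X N s ω‖ₑ) := fun N => (hXm N).enorm
  have hA_meas : ∀ N, Measurable fun s => ∫⁻ ω, ‖X N s ω‖ₑ ∂P N := fun N =>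
    (hunc N).lintegral_prod_right
  have hF_meas : ∀ N, Measurable fun ω => ∫⁻ s in Icc 0 τ, ‖X N s ω‖ₑ := fun N =>
    (hunc N).lintegral_prod_left
  have hsw : ∀ N, AEMeasurable (uncurry fun ω s => ‖X N s ω‖ₑ)
      ((P N).prod (volume.restrict (Icc 0 τ))) := fun N =>
    ((hXm N).comp measurable_swap).enorm.aemeasurable
  -- Markov + Tonelli: `P N {δ < |∫ X ds|} ≤ δ⁻¹ ∫₀^τ ∫⁻ ‖X N s‖ₑ dP N ds`
  have hbound : ∀ N, P N {ω | δ < |∫ s in Icc 0 τ, X N s ω|}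
      ≤ (∫⁻ s in Icc 0 τ, ∫⁻ ω, ‖X N s ω‖ₑ ∂P N) / ENNReal.ofReal δ := by
    intro N
    calc P N {ω | δ < |∫ s in Icc 0 τ, X N s ω|}
        ≤ P N {ω | ENNReal.ofReal δ ≤ ∫⁻ s in Icc 0 τ, ‖X N s ω‖ₑ} := by
          refine measure_mono fun ω hω => ?_
          simp only [Set.mem_setOf_eq] at hω ⊢
          calc ENNReal.ofReal δ ≤ ENNReal.ofReal |∫ s in Icc 0 τ, X N s ω| :=
                ENNReal.ofReal_le_ofReal hω.le
            _ = ‖∫ s in Icc 0 τ, X N s ω‖ₑ := (Real.enorm_eq_ofReal_abs _).symm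
            _ ≤ ∫⁻ s in Icc 0 τ, ‖X N s ω‖ₑ := enorm_integral_le_lintegral_enorm _
      _ ≤ (∫⁻ ω, (∫⁻ s in Icc 0 τ, ‖X N s ω‖ₑ) ∂P N) / ENNReal.ofReal δ :=
          meas_ge_le_lintegral_div (hF_meas N).aemeasurable (ENNReal.ofReal_pos.2 hδ).ne'
            ENNReal.ofReal_ne_top
      _ = (∫⁻ s in Icc 0 τ, ∫⁻ ω, ‖X N s ω‖ₑ ∂P N) / ENNReal.ofReal δ := by
          rw [lintegral_lintegral_swap (hsw N)]
  -- dominated convergence in `s ∈ [0, τ]`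
  have hDCT : Tendsto (fun N => ∫⁻ s in Icc 0 τ, ∫⁻ ω, ‖X N s ω‖ₑ ∂P N) atTop (𝓝 0) := by
    have h := tendsto_lintegral_of_dominated_convergence (μ := volume.restrict (Icc 0 τ))
      (F := fun N s => ∫⁻ ω, ‖X N s ω‖ₑ ∂P N) (f := fun _ => 0)
      (fun _ => 2 + ENNReal.ofReal C) hA_meas ?_ ?_ ?_
    · simpa only [lintegral_zero] using h
    · intro N
      refine (ae_restrict_iff' measurableSet_Icc).2 (Eventually.of_forall fun s hs => ?_)
      calc ∫⁻ ω, ‖X N s ω‖ₑ ∂P N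
          ≤ ENNReal.ofReal 1 + ENNReal.ofReal 1 * P N {ω | 1 < |X N s ω|}
              + ENNReal.ofReal (C / 1) :=
            lintegral_enorm_le_truncation (P N) (hXs N s) ((hL2 N s hs).integrable_sq) (hC N s hs)
              one_pos
        _ ≤ 1 + 1 + ENNReal.ofReal (C / 1) := by
            rw [ENNReal.ofReal_one, one_mul]
            exact add_le_add_three le_rfl prob_le_one le_rfl
        _ = 2 + ENNReal.ofReal C := by rw [div_one, one_add_one_eq_two]
    · rw [setLIntegral_const]
      exact ENNReal.mul_ne_top (by simp) measure_Icc_lt_top.ne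
    · refine (ae_restrict_iff' measurableSet_Icc).2 (Eventually.of_forall fun s hs => ?_)
      exact tendsto_lintegral_enorm_of_tendsto_measure P (fun N => hXs N s)
        (fun N => (hL2 N s hs).integrable_sq) (fun N => hC N s hs) (hlim s hs)
  -- conclusion: squeeze between `0` and `δ⁻¹ ∫₀^τ ∫⁻ ‖X N s‖ₑ`
  have hlim' : Tendsto (fun N => (∫⁻ s in Icc 0 τ, ∫⁻ ω, ‖X N s ω‖ₑ ∂P N) / ENNReal.ofReal δ)
      atTop (𝓝 0) := by
    have h := ENNReal.Tendsto.div_const hDCT (b := ENNReal.ofReal δ)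
      (Or.inr (ENNReal.ofReal_pos.2 hδ).ne')
    simpa only [ENNReal.zero_div] using h
  exact tendsto_of_tendsto_of_tendsto_of_le_of_le tendsto_const_nhds hlim' (fun N => zero_le)
    hbound

end

end Summit.AtomisticToContinuum.HydrodynamicLimit.Theorems.HemisphereAffineSlaving
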